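import Summits.QuantumFields.BalabanUV.Gaps.D4WalkBlockNeumann
import Summits.QuantumFields.BalabanUV.T4Continuum.Spine.NE5.TwoRunPencilWalks

/-!
# Spine/NE5/TwoRunPencilBlocks — row NE5's two-run W2 pencil in the BLOCK currency of row (D4)'s NODE O (print's
# cube-to-cube operator norms, [B9] (3.108)): pencil members of two termwise-close `BlockWalkExpansion`s are
# `BlockWalkExpansion`s with letters ×`(1 + τr)` (cell `pub-balaban-gaps`, seat `ne5` gen 6)

WHY (triage sheet `HOME/ne/NE5.md` §7 (x6), §12 standing offer (s6-b)).  Since 2026-08-23 the (D4) seat g1-p2 repairs the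
located limit V47 by a BLOCK currency one level above `JointWalkExpansion` (`Gaps/D4WalkBlock`, p356951 ✓: `blockNorm` =
the ℓ^∞ → ℓ^∞ norm of the `(y, y′)` block between two M-cubes, `BlockWalkExpansion` = the NODE-O object with the per-term
ENTRY bound replaced by the per-term BLOCK bound — print's (3.108) currency, NO fibre factor in products ∕ Neumann steps).
Gen 5's T8 (`TwoRunPencilWalks.jointWalkExpansion_pencil`) typed NE5's two-run pencil in the entry currency; THIS FILE is
its block twin, so that NE5's pencil data feed the block-currency product ∕ Neumann ∕ gluing steps (`D4WalkBlockProduct`,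
`D4WalkBlockNeumann`, `blockWalkExpansion_glue`) exactly as T8 feeds the entrywise ones:
* `blockWalkExpansion_pencil` — two kernel families on the same walk skeleton and σ-region, both block walk expansions,
  whose TERMS are close in BLOCK-walk-weighted currency `‖T_B ω σ u − T_A ω σ u‖_{y,y′} ≤ r·A_ω·e^{−ρD_ω(y,y′)}` (the
  two-run rate `r` delivered termwise for the LOCAL factors, row NE2's currency): for `‖t‖ ≤ τ` the pencil member
  `T_A + t(T_B − T_A)` is a block walk expansion of `K_A + t(K_B − K_A)` with amplitudes `(1 + τr)A_ω`, constant
  `(1 + τr)K̄` — `blockNorm_add_le` + `blockNorm_smul_le` for the block field, every other field BY NAME from T8 applied to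
  the entry read-offs (`BlockWalkExpansion.toJoint`, `norm_entry_le_blockNorm`);
* `blockWalkExpansion_pencil_reach` — `τ = s∕r`: constants `(1 + s)`, INDEPENDENT of the rate `r` (NE5's fixed reach);
* `blockWalkExpansion_pencilParam` — the interpolation parameter as a configuration coordinate (`E × ℂ`), reference
  configuration `(0,0)` = run A: joint analyticity in (background, `t`) in the block currency too;
* `blockWalkExpansion_inv_pencil_reach` — the COVARIANCE along the pencil in block currency at reach `s` (block twin of
  `NeumannPencilCovariance.walkMajorants_inv_pencil_reach` over g1-p2's `D4WalkBlockNeumann.blockWalkExpansion_inv_pencil`,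
  p-id at its LANDED line): direction = the two runs' precision DIFFERENCE family with amplitudes `r·A_E`, constant `r·K̄_E`;
  for `‖t‖ ≤ s∕r` the inverse `(A + tP)⁻¹` is a `BlockWalkExpansion` whose letters mention neither `t` nor `r` NOR a fibre
  letter: margin `q = c(c·K̄_C·(s·K̄_E)·c′)c′`, constant `K̄_C(1 − q)⁻¹`.
HONEST FRAMING.  Bookkeeping by linearity over LANDED hypothesis shapes (`D4WalkBlock`, `TwoRunPencilWalks`); the families,
their closeness `r`, the reach and every constant are HYPOTHESES; nothing of Bałaban's is constructed or asserted; NE5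
NOT PRINTED ∕ NOT PROVED; (D4) 0∕1; 0∕12 NE5 leaves; words UNCHANGED.  Rung (B)+1 on a FIXED finite T⁴ — NOT continuum,
NOT infinite volume, NOT mass gap, NOT Clay.  Spine PROVED 0∕9.  0 sorry, 0 `def`.
Sources: [B9] = T. Bałaban, CMP **99** (1985) [Balaban1985BackgroundPropagators] Thm 3.10 (3.107)–(3.108) p. 416; [II] =
CMP **116** (1988) [Balaban1988RG2Cluster] (1.5) p. 3, (1.11) p. 5, p. 13, p. 15.  Nothing here is a claim about the mass gap.
-/

noncomputable section

namespace Summit.QuantumFields.BalabanUV.T4Continuum.Spine.NE5.TwoRunPencilBlocks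

open Metric Set Matrix Finset
open Literature.MathematicalPhysics.QuantumFieldTheory.Balaban1983to89
open Literature.MathematicalPhysics.QuantumFieldTheory.Balaban1983to89.TreeLengthTorus (TPt)
open Literature.MathematicalPhysics.QuantumFieldTheory.Balaban1983to89.B5TorusCover (UT)
open Literature.MathematicalPhysics.QuantumFieldTheory.Balaban1983to89.B9SectDWalk (DomBy infConv chainConst chainDist)
open Literature.MathematicalPhysics.QuantumFieldTheory.Balaban1983to89.B9Thm34Ext (toB6)
open Literature.MathematicalPhysics.QuantumFieldTheory.Balaban1983to89.B9Thm37GlueTorus (torusGeom)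
open Literature.MathematicalPhysics.QuantumFieldTheory.Balaban1983to89.B11SectG (RowSum)
open Summit.QuantumFields.BalabanUV.Gaps.D4WalkBlock
  (blockNorm blockNorm_nonneg norm_entry_le_blockNorm blockNorm_add_le blockNorm_smul_le BlockWalkExpansion)
open Summit.QuantumFields.BalabanUV.Gaps.D4WalkBlockNeumann (blockWalkExpansion_inv_pencil)
open Summit.QuantumFields.BalabanUV.T4Continuum.Spine.NE5.TwoRunPencilWalks
  (jointWalkExpansion_pencil jointWalkExpansion_pencilParam)

variable {d N' : ℕ} {ν : ℕ} {K : Fin ν → ℕ} [∀ i, NeZero (K i)]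
variable {p n : Type} [Fintype p] [Fintype n]
variable {E : Type*} [NormedAddCommGroup E] [NormedSpace ℂ E]
variable {c : B13.Consts} {cub : p → UT K} {cubn : n → UT K}
variable {KA KB : (TPt d N' → ℂ) → E → Matrix p n ℂ}
variable {X : Finset (UT K)} {R ε kap Kbar RB εB kapB KbarB : ℝ}
variable {W : Type} {TA TB : W → (TPt d N' → ℂ) → E → Matrix p n ℂ} {SX : Set W} {A AB : W → ℝ}
variable {D : W → UT K → UT K → ℝ} {ρ ρB : ℝ}

omit [∀ i, NeZero (K i)] in
/-- The block pencil estimate: `‖M_A + t(M_B − M_A)‖_{y,y′} ≤ (1 + τr)·m` from `‖M_A‖_{y,y′} ≤ m`, `‖M_B − M_A‖_{y,y′} ≤ r·m`,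
`‖t‖ ≤ τ` (subadditivity and homogeneity of the block norm). [cite: Balaban1985BackgroundPropagators, (3.108) p.416] (elementary API) -/
theorem blockNorm_pencil_le {MA MB : Matrix p n ℂ} {t : ℂ} {m r τ : ℝ} (y y' : UT K)
    (hA : blockNorm cub cubn MA y y' ≤ m) (hAB : blockNorm cub cubn (MB - MA) y y' ≤ r * m) (ht : ‖t‖ ≤ τ) :
    blockNorm cub cubn (MA + t • (MB - MA)) y y' ≤ (1 + τ * r) * m :=
  calc blockNorm cub cubn (MA + t • (MB - MA)) y y'
      ≤ blockNorm cub cubn MA y y' + blockNorm cub cubn (t • (MB - MA)) y y' := blockNorm_add_le cub cubn _ _ y y'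
    _ ≤ m + ‖t‖ * blockNorm cub cubn (MB - MA) y y' := add_le_add hA (blockNorm_smul_le cub cubn t _ y y')
    _ ≤ m + τ * (r * m) :=
        add_le_add_right (mul_le_mul ht hAB (blockNorm_nonneg cub cubn _ y y') ((norm_nonneg t).trans ht)) m
    _ = (1 + τ * r) * m := by ring

omit [∀ i, NeZero (K i)] [NormedSpace ℂ E] in
/-- Block closeness of the terms implies entry closeness (read-off), the input currency of T8. [cite: Balaban1985BackgroundPropagators, (3.108) p.416] (elementary API) -/
theorem entry_close_of_block_close {r : ℝ}
    (hdiffB : ∀ ω, ∀ σ : TPt d N' → ℂ, (∀ j, ‖σ j‖ ≤ Real.exp c.κ₁) → ∀ u ∈ ball (0 : E) R,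
      ∀ y y', blockNorm cub cubn (TB ω σ u - TA ω σ u) y y' ≤ r * (A ω * Real.exp (-(ρ * D ω y y')))) :
    ∀ ω, ∀ σ : TPt d N' → ℂ, (∀ j, ‖σ j‖ ≤ Real.exp c.κ₁) → ∀ u ∈ ball (0 : E) R,
      ∀ i j, ‖TB ω σ u i j - TA ω σ u i j‖ ≤ r * (A ω * Real.exp (-(ρ * D ω (cub i) (cubn j)))) :=
  fun ω σ hσ u hu i j => by
    have h := norm_entry_le_blockNorm cub cubn (TB ω σ u - TA ω σ u) i j
    rw [Matrix.sub_apply] at h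
    exact h.trans (hdiffB ω σ hσ u hu (cub i) (cubn j))

/-- **THE TWO-RUN PENCIL IN THE BLOCK CURRENCY.**  Two kernel families `K_A`, `K_B` on the same walk skeleton `(W, SX, D, ρ)`
and σ-region, both `BlockWalkExpansion`s on σ-polydisc × `R`-ball (run B's own amplitudes ∕ constants unused; `R ≤ R_B`),
with TERMWISE-close terms in BLOCK-walk-weighted currency `‖T_B ω σ u − T_A ω σ u‖_{y,y′} ≤ r·A_ω·e^{−ρD_ω(y,y′)}`: for
every `t ∈ ℂ` with `‖t‖ ≤ τ` the pencil member is a `BlockWalkExpansion` of `K_A + t(K_B − K_A)` with amplitudes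
`(1 + τr)·A_ω` and constant `(1 + τr)·K̄`; entrywise fields from T8 (`jointWalkExpansion_pencil` on the read-offs).
[cite: Balaban1985BackgroundPropagators, Thm 3.10 (3.107)–(3.108) p.416; Balaban1988RG2Cluster, (1.5) p.3, (1.11) p.5, p.13, p.15] -/
theorem blockWalkExpansion_pencil
    (hA : BlockWalkExpansion c cub cubn KA X R ε kap Kbar TA SX A D ρ)
    (hB : BlockWalkExpansion c cub cubn KB X RB εB kapB KbarB TB SX AB D ρB) (hRB : R ≤ RB)
    {r τ : ℝ} (hr : 0 ≤ r) (hτ : 0 ≤ τ)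
    (hdiffB : ∀ ω, ∀ σ : TPt d N' → ℂ, (∀ j, ‖σ j‖ ≤ Real.exp c.κ₁) → ∀ u ∈ ball (0 : E) R,
      ∀ y y', blockNorm cub cubn (TB ω σ u - TA ω σ u) y y' ≤ r * (A ω * Real.exp (-(ρ * D ω y y'))))
    {t : ℂ} (ht : ‖t‖ ≤ τ) :
    BlockWalkExpansion c cub cubn (fun σ u => KA σ u + t • (KB σ u - KA σ u)) X R ε kap ((1 + τ * r) * Kbar)
      (fun ω σ u => TA ω σ u + t • (TB ω σ u - TA ω σ u)) SX (fun ω => (1 + τ * r) * A ω) D ρ := by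
  have hJ := jointWalkExpansion_pencil hA.toJoint hB.toJoint hRB hr hτ (entry_close_of_block_close hdiffB) ht
  exact
  { hasSum := hJ.hasSum
    termAnalytic := hJ.termAnalytic
    majB := fun ω σ hσ u hu y y' => by
      rw [mul_assoc]
      exact blockNorm_pencil_le y y' (hA.majB ω σ hσ u hu y y') (hdiffB ω σ hσ u hu y y') ht
    majSum := hJ.majSum
    indep := hJ.indep
    through := hJ.through
    A_nonneg := hJ.A_nonneg
    D_nonneg := hJ.D_nonneg }

/-- **REACH `s` WITH CONSTANTS `1 + s`, UNIFORMLY IN THE RATE** (block twin of `jointWalkExpansion_pencil_reach`): for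
`‖t‖ ≤ s∕r` the letters are `(1 + s)·A_ω`, `(1 + s)·K̄`, independent of `r`. [cite: Balaban1988RG2Cluster, (1.5) p.3, (2.16) p.16; Balaban1985BackgroundPropagators, Thm 3.10 p.416] -/
theorem blockWalkExpansion_pencil_reach
    (hA : BlockWalkExpansion c cub cubn KA X R ε kap Kbar TA SX A D ρ)
    (hB : BlockWalkExpansion c cub cubn KB X RB εB kapB KbarB TB SX AB D ρB) (hRB : R ≤ RB)
    {r s : ℝ} (hr : 0 < r) (hs : 0 ≤ s)
    (hdiffB : ∀ ω, ∀ σ : TPt d N' → ℂ, (∀ j, ‖σ j‖ ≤ Real.exp c.κ₁) → ∀ u ∈ ball (0 : E) R,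
      ∀ y y', blockNorm cub cubn (TB ω σ u - TA ω σ u) y y' ≤ r * (A ω * Real.exp (-(ρ * D ω y y'))))
    {t : ℂ} (ht : ‖t‖ ≤ s / r) :
    BlockWalkExpansion c cub cubn (fun σ u => KA σ u + t • (KB σ u - KA σ u)) X R ε kap ((1 + s) * Kbar)
      (fun ω σ u => TA ω σ u + t • (TB ω σ u - TA ω σ u)) SX (fun ω => (1 + s) * A ω) D ρ := by
  have hsr : 1 + s / r * r = 1 + s := by rw [div_mul_cancel₀ s hr.ne']
  simpa only [hsr] using blockWalkExpansion_pencil hA hB hRB hr.le (div_nonneg hs hr.le) hdiffB ht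

omit [Fintype p] [Fintype n] [NormedSpace ℂ E] in
/-- The scaled second coordinate stays below `τ` on the `R`-ball of `E × ℂ`. [folklore] -/
private theorem norm_scaled_snd_le {τ : ℝ} (hτ : 0 ≤ τ) {v : E × ℂ} (hv : v ∈ ball (0 : E × ℂ) R) :
    ‖(((τ / R : ℝ) : ℂ) * v.2)‖ ≤ τ := by
  have hR : 0 < R := by
    have h := mem_ball_zero_iff.1 hv
    exact lt_of_le_of_lt (norm_nonneg _) h
  have h2 : ‖v.2‖ ≤ R := (norm_snd_le v).trans (mem_ball_zero_iff.1 hv).le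
  rw [norm_mul, Complex.norm_real, Real.norm_of_nonneg (div_nonneg hτ hR.le)]
  calc τ / R * ‖v.2‖ ≤ τ / R * R := by gcongr
    _ = τ := div_mul_cancel₀ τ hR.ne'

/-- **THE PENCIL PARAMETER AS A CONFIGURATION COORDINATE, block currency** (twin of `jointWalkExpansion_pencilParam`):
over `E × ℂ` the family `(u,t) ↦ K_A(σ,u) + (τ∕R)t·(K_B(σ,u) − K_A(σ,u))` is a `BlockWalkExpansion` on the `R`-ball with
amplitudes `(1 + τr)A_ω`, constant `(1 + τr)K̄`, reference configuration `(0,0)` = run A — so the block-currency product ∕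
Neumann ∕ gluing steps run on row (D4)'s seam ball × row NE5's pencil AT ONCE, and `.toJoint.analyticOnBall` is joint
analyticity in (background, interpolation). [cite: Balaban1988RG2Cluster, (1.5) p.3, p.15; Balaban1985BackgroundPropagators, Thm 3.10 p.416] -/
theorem blockWalkExpansion_pencilParam
    (hA : BlockWalkExpansion c cub cubn KA X R ε kap Kbar TA SX A D ρ)
    (hB : BlockWalkExpansion c cub cubn KB X RB εB kapB KbarB TB SX AB D ρB) (hRB : R ≤ RB)
    {r τ : ℝ} (hr : 0 ≤ r) (hτ : 0 ≤ τ)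
    (hdiffB : ∀ ω, ∀ σ : TPt d N' → ℂ, (∀ j, ‖σ j‖ ≤ Real.exp c.κ₁) → ∀ u ∈ ball (0 : E) R,
      ∀ y y', blockNorm cub cubn (TB ω σ u - TA ω σ u) y y' ≤ r * (A ω * Real.exp (-(ρ * D ω y y')))) :
    BlockWalkExpansion c cub cubn
      (fun σ (v : E × ℂ) => KA σ v.1 + (((τ / R : ℝ) : ℂ) * v.2) • (KB σ v.1 - KA σ v.1)) X R ε kap
      ((1 + τ * r) * Kbar)
      (fun ω σ (v : E × ℂ) => TA ω σ v.1 + (((τ / R : ℝ) : ℂ) * v.2) • (TB ω σ v.1 - TA ω σ v.1)) SX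
      (fun ω => (1 + τ * r) * A ω) D ρ := by
  have hJ := jointWalkExpansion_pencilParam hA.toJoint hB.toJoint hRB hr hτ (entry_close_of_block_close hdiffB)
  exact
  { hasSum := hJ.hasSum
    termAnalytic := hJ.termAnalytic
    majB := fun ω σ hσ v hv y y' => by
      have hu : v.1 ∈ ball (0 : E) R := by
        rw [mem_ball_zero_iff] at hv ⊢
        exact lt_of_le_of_lt (norm_fst_le v) hv
      rw [mul_assoc]
      exact blockNorm_pencil_le y y' (hA.majB ω σ hσ v.1 hu y y') (hdiffB ω σ hσ v.1 hu y y')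
        (norm_scaled_snd_le hτ hv)
    majSum := hJ.majSum
    indep := hJ.indep
    through := hJ.through
    A_nonneg := hJ.A_nonneg
    D_nonneg := hJ.D_nonneg }

/-! ## §2. The covariance along the pencil in block currency, reach form (rate-free, fibre-free letters) -/

section Covariance

variable [DecidableEq n]
variable {cub' : n → UT K} {X' : Finset (UT K)}
variable {WC WP : Type}
variable {TC : WC → (TPt d N' → ℂ) → E → Matrix n n ℂ} {Cm : (TPt d N' → ℂ) → E → Matrix n n ℂ}
variable {SXC : Set WC} {AC : WC → ℝ} {DC : WC → UT K → UT K → ℝ}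
variable {TP : WP → (TPt d N' → ℂ) → E → Matrix n n ℂ} {Pm : (TPt d N' → ℂ) → E → Matrix n n ℂ}
variable {SXP : Set WP} {AE : WP → ℝ} {DP : WP → UT K → UT K → ℝ}
variable {Am : (TPt d N' → ℂ) → E → Matrix n n ℂ}
variable {R' ρC εC κC KbarC ρP εP κP KbarE ρ' ε' ρs σ₁ c₁ σ' c' κs κ' : ℝ}

/-- **THE COVARIANCE ALONG NE5's PENCIL, BLOCK CURRENCY, REACH `s`.**  Run A's covariance `C` (`A·C = 1`) and the two runs'
precision DIFFERENCE family `P` (amplitudes `r·A_E`, constant `r·K̄_E`, the local two-run rate `r > 0`) as `BlockWalkExpansion`s;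
the windows of `D4WalkBlockNeumann.blockWalkExpansion_inv_pencil`; margin `q = c₁(c₁K̄_C(sK̄_E)c′)c′ < 1` at NE5's reach `s`.
Then for every `‖t‖ ≤ s∕r` the covariance `(A + tP)⁻¹` of the precision pencil is a `BlockWalkExpansion` with constant
`K̄_C(1 − q)⁻¹` and step amplitudes `c₁·A_C·(s·A_E)` — no `t`, no `r`, no fibre letter.
[cite: Balaban1985BackgroundPropagators, (3.130) p.421, p.422, Thm 3.10 p.416; Balaban1988RG2Cluster, (1.5) p.3, (2.16) p.16, p.17] -/
theorem blockWalkExpansion_inv_pencil_reach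
    (hC : BlockWalkExpansion c cub' cub' Cm X' R' εC κC KbarC TC SXC AC DC ρC)
    {r s : ℝ} (hr : 0 < r) (hs : 0 ≤ s)
    (hP : BlockWalkExpansion c cub' cub' Pm X' R' εP κP (r * KbarE) TP SXP (fun ω => r * AE ω) DP ρP)
    (hCdom : ∀ ω, DomBy (toB6 (torusGeom K 0 0 0) 0 True) (DC ω))
    (hPdom : ∀ ω, DomBy (toB6 (torusGeom K 0 0 0) 0 True) (DP ω))
    (hAC : ∀ σ₀ : TPt d N' → ℂ, (∀ j, ‖σ₀ j‖ ≤ Real.exp c.κ₁) → ∀ u ∈ ball (0 : E) R', Am σ₀ u * Cm σ₀ u = 1)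
    (hrow : RowSum (toB6 (torusGeom K 0 0 0) 0 True) σ₁ c₁) (hrow' : RowSum (toB6 (torusGeom K 0 0 0) 0 True) σ' c')
    (hσ₁ : 0 ≤ σ₁) (hσ' : 0 ≤ σ') (hc₁ : 0 ≤ c₁) (hc' : 0 ≤ c')
    (hε : 0 ≤ ε') (hερ : ε' ≤ ρ') (hρs : ρ' + σ₁ ≤ ρs) (hρsC : ρs + σ₁ ≤ ρC) (hρsP : ρs ≤ ρP)
    (hwC : ρC - εC ≤ ρ' - ε') (hwP : ρP - εP ≤ ρ' - ε')
    (hKC : 0 ≤ KbarC) (hKE : 0 ≤ KbarE)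
    (hκs : 0 ≤ κs) (hκsP : κs ≤ κP) (hκsC : κs + σ' ≤ κC) (hκ : 0 ≤ κ') (hκC : κ' ≤ κC) (hκκs : κ' + σ' ≤ κs)
    {t : ℂ} (ht : ‖t‖ ≤ s / r)
    (hq : c₁ * (c₁ * KbarC * (s * KbarE) * c') * c' < 1) :
    BlockWalkExpansion c cub' cub' (fun σ₀ u => (Am σ₀ u + t • Pm σ₀ u)⁻¹) X' R' ε' κ'
      (KbarC * (1 - c₁ * (c₁ * KbarC * (s * KbarE) * c') * c')⁻¹)
      (fun (q : List (WC × WP) × WC) σ₀ u =>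
        q.1.foldr (fun i M => (TC i.1 σ₀ u * ((-t) • TP i.2 σ₀ u)) * M) (TC q.2 σ₀ u))
      {q | q.2 ∈ SXC ∨ ∃ i ∈ q.1, i.1 ∈ SXC ∨ i.2 ∈ SXP}
      (fun q => chainConst 1 c₁ (fun i : WC × WP => c₁ * (AC i.1 * (s * AE i.2))) (AC q.2) q.1)
      (fun q => chainDist (g := toB6 (torusGeom K 0 0 0) 0 True)
        (fun i : WC × WP => infConv (g := toB6 (torusGeom K 0 0 0) 0 True) (DC i.1) (DP i.2)) (DC q.2) q.1) ρ' := by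
  have e : ∀ x : ℝ, s / r * (r * x) = s * x := fun x => by rw [← mul_assoc, div_mul_cancel₀ s hr.ne']
  have hq' : c₁ * (c₁ * KbarC * (s / r * (r * KbarE)) * c') * c' < 1 := by rwa [e]
  have h := blockWalkExpansion_inv_pencil (τ := s / r) hC hP hCdom hPdom hAC hrow hrow' hσ₁ hσ' hc₁ hc' hε hερ hρs hρsC
    hρsP hwC hwP hKC (mul_nonneg hr.le hKE) hκs hκsP hκsC hκ hκC hκκs (div_nonneg hs hr.le) ht hq'
  simpa only [e] using h

end Covariance

end Summit.QuantumFields.BalabanUV.T4Continuum.Spine.NE5.TwoRunPencilBlocks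

end
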